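import Literature.NumberTheory.Transcendental.FormIntegrationBridgeProofs
import Literature.NumberTheory.Transcendental.FormIntegrationCharts
import Literature.NumberTheory.Transcendental.FormIntegrationFlat
import Mathlib.Geometry.Manifold.VectorBundle.LocalFrame
import Mathlib.Analysis.InnerProductSpace.GramMatrix
import Mathlib.Analysis.SpecialFunctions.Sqrt
import HarnessLib

/-!
# The Riemannian volume form of a continuous orientation is smooth

Topic: integration of differential forms on oriented manifolds; this file discharges the named
fact `Literature.NumberTheory.Transcendental.isSmoothForm_riemannianVolumeForm_of_isContinuousOrientation`
of `Literature/NumberTheory/Transcendental/FormIntegration.lean` (the bridge lemma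
"metric-free ⇒ metric"): on a `C^∞` manifold `M` (boundary and corners allowed) with a smooth
Riemannian metric on the tangent bundle (Mathlib's `IsContMDiffRiemannianBundle I ∞`) and a
*continuous* orientation family `o` (`IsContinuousOrientation o`), the Riemannian volume form
`riemannianVolumeForm o = (x ↦ vol_{o x})` is a smooth top-degree form (`IsSmoothForm`).
Lee (2013), Prop. 15.29 (the Riemannian volume form is a smooth `n`-form) via the coordinate
formula of Prop. 15.31, `ω_g = √(det g_{ij}) dx¹ ∧ ⋯ ∧ dxⁿ` in oriented coordinates.
Everything is proved.

## Main statements (all proved)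

* `Literature.NumberTheory.Transcendental.abs_volumeForm_apply_eq_sqrt_det_gram`: on an
  oriented finite-dimensional inner product space, `|vol (v₁, …, vₙ)| = √(det ⟪vᵢ, vⱼ⟫)`
  (Lee (2013), proof of Prop. 15.31: `det (g_{ij}) = det (Aᵀ A) = (det A)²`), whence
  `vol (v) = sign (vol (v)) · √(det ⟪vᵢ, vⱼ⟫)` (`volumeForm_apply_eq_sign_mul_sqrt`).
* `Literature.NumberTheory.Transcendental.localFrame_trivializationAt_eq_tangentCoordChange`:
  Mathlib's local frame of the tangent bundle induced by the trivialization at `x₀` and a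
  basis `b` of the model space is the coordinate frame `x ↦ D(φ₀⁻¹)(φ₀ x) bᵢ` of the chart
  `φ₀ = extChartAt I x₀`; it is smooth (`contMDiffAt_localFrame_trivializationAt`, Mathlib's
  `contMDiffAt_localFrame_of_mem`) and its Gram determinant `det ⟪sᵢ, sⱼ⟫` is smooth
  (`contMDiffAt_det_gram_localFrame`, Mathlib's `ContMDiffAt.inner_bundle`).
* `Literature.NumberTheory.Transcendental.inChart_riemannianVolumeForm_extChartAt_apply`: the
  coefficient of the chart representative of `vol_o` on the reference frame at the chart
  point of `x` is `vol_{o x} (s₁ x, …, sₙ x)`.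
* `Literature.NumberTheory.Transcendental.isSmoothForm_riemannianVolumeForm_of_isContinuousOrientation_holds`:
  the discharge.

## Proof architecture (Lee (2013), Prop. 15.29 / 15.31)

Fix `x₀` and the chart `φ₀ = extChartAt I x₀`, with coordinate frame `sᵢ` as above. Near the
centre, within `range I`, the chart representative of `vol_o` is
`y ↦ vol_{o (φ₀⁻¹ y)} (s (φ₀⁻¹ y)) • dx¹ ∧ ⋯ ∧ dxⁿ` (`ContinuousAlternatingMap.eq_apply_basis_smul`),
and `vol_{o x} (s x) = sign · √(det ⟪sᵢ x, sⱼ x⟫)` where the sign is the chart sign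
`chartSign o x₀ y` (`chartSign_eq_sign_inChart_riemannianVolumeForm` of the sibling file
`FormIntegrationBridgeProofs.lean`: `someVector` and `vol` span the same ray), locally constant
and nonzero near the centre by the hypothesis `IsContinuousOrientation o`. The Gram determinant
is a smooth function on `M` near `x₀` (smooth metric, smooth frame) and does not vanish at `x₀`
(the frame is a basis, `Matrix.det_gram_ne_zero_iff_linearIndependent`), so its square root
read in the chart is `C^∞` within `range I` at `φ₀ x₀` (`Real.contDiffAt_sqrt`,
`contMDiffAt_iff`).

## Mathlib status

Mathlib (pinned v4.32.0) has all the ingredients: Riemannian bundles and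
`ContMDiffAt.inner_bundle`, local frames of vector bundles (`Trivialization.localFrame`,
`contMDiffAt_localFrame_of_mem`), `TangentBundle.symmL_trivializationAt_eq_core`, Gram matrices
(`Matrix.gram_eq_conjTranspose_mul`, `Matrix.det_gram_ne_zero_iff_linearIndependent`),
`Orientation.volumeForm_robust'` and `Real.contDiffAt_sqrt`; it has no volume form of an
oriented Riemannian manifold as a differential form. No new definition is introduced here.

## References

* J. M. Lee, *Introduction to Smooth Manifolds*, 2nd ed., GTM 218, Springer (2013),
  Prop. 15.29 and Prop. 15.31 (PDF pp. 421–423), Prop. 15.6 (PDF p. 415).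
* F. W. Warner, *Foundations of Differentiable Manifolds and Lie Groups*, GTM 94, Springer
  (1983), 4.10 (volume form of an oriented Riemannian manifold).
-/

noncomputable section

open scoped Manifold ContDiff Topology
open Bundle Set Module Filter

namespace Literature.NumberTheory.Transcendental

/-! ### Linear algebra: the volume form and Gram determinants -/

section LinAlg

variable {V : Type*} [NormedAddCommGroup V] [InnerProductSpace ℝ V] [FiniteDimensional ℝ V]
  {n : ℕ} [Fact (finrank ℝ V = n)]

/-- **`|vol (v)| = √(det Gram (v))`**: on an oriented finite-dimensional real inner product
space, the absolute value of the volume form on a family `v₁, …, vₙ` is the square root of the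
Gram determinant `det (⟪vᵢ, vⱼ⟫)`. With `A` the matrix of `v` in an orthonormal basis,
`vol (v) = ± det A` (`Orientation.volumeForm_robust'`) and `Gram (v) = Aᵀ A`
(`Matrix.gram_eq_conjTranspose_mul`). Lee (2013), proof of Prop. 15.31.
[cite: LeeSmoothManifolds2013, Prop. 15.31] -/
theorem abs_volumeForm_apply_eq_sqrt_det_gram (oV : Orientation ℝ V (Fin n)) (v : Fin n → V) :
    |oV.volumeForm v| = Real.sqrt (Matrix.gram ℝ v).det := by
  set b : OrthonormalBasis (Fin n) ℝ V := Literature.Geometry.Kaehler.stdOrthonormalBasisFin V n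
  have hm : Matrix.gram ℝ v = (b.toBasis.toMatrix v).conjTranspose * b.toBasis.toMatrix v :=
    Matrix.gram_eq_conjTranspose_mul b v
  rw [oV.volumeForm_robust' b, Module.Basis.det_apply, hm, Matrix.det_mul,
    Matrix.det_conjTranspose, star_trivial, Real.sqrt_mul_self_eq_abs]

/-- `vol (v) = sign (vol (v)) · √(det Gram (v))` (Lee (2013), proof of Prop. 15.31:
`f = det A = ±√(det (g_{ij}))`). [cite: LeeSmoothManifolds2013, Prop. 15.31] -/
theorem volumeForm_apply_eq_sign_mul_sqrt (oV : Orientation ℝ V (Fin n)) (v : Fin n → V) :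
    oV.volumeForm v = Real.sign (oV.volumeForm v) * Real.sqrt (Matrix.gram ℝ v).det := by
  rw [← abs_volumeForm_apply_eq_sqrt_det_gram]
  rcases lt_trichotomy (oV.volumeForm v) 0 with h | h | h
  · rw [Real.sign_of_neg h, abs_of_neg h]
    ring
  · rw [h, abs_zero, mul_zero]
  · rw [Real.sign_of_pos h, abs_of_pos h, one_mul]

end LinAlg

/-! ### The coordinate frame of a chart as a smooth local frame of the tangent bundle -/

section Frame

variable {E : Type*} [NormedAddCommGroup E] [NormedSpace ℝ E]
  {H : Type*} [TopologicalSpace H] {I : ModelWithCorners ℝ E H}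
  {M : Type*} [TopologicalSpace M] [ChartedSpace H M] [IsManifold I ∞ M]
  {ι : Type*} (b : Basis ι ℝ E)

/-- **The local frame induced by the trivialization at `x₀` is the coordinate frame of the chart
at `x₀`.** For `x` in the chart source, Mathlib's `(trivializationAt E (TangentSpace I) x₀).localFrame b i x`
is `tangentCoordChange I x₀ x x (b i)`, i.e. the vector `D(φ₀⁻¹)(φ₀ x) bᵢ` read in the chart at
`x` (`TangentBundle.symmL_trivializationAt_eq_core`; cf. `mfderivWithin_extChartAt_symm_apply_eq`).
Lee (2013), Ch. 3 (coordinate vectors `∂/∂xⁱ`). [folklore] -/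
theorem localFrame_trivializationAt_eq_tangentCoordChange {x₀ x : M}
    (hx : x ∈ (chartAt H x₀).source) (i : ι) :
    (trivializationAt E (TangentSpace I) x₀).localFrame b i x =
      tangentCoordChange I x₀ x x (b i) := by
  have hx' : x ∈ (trivializationAt E (TangentSpace I) x₀).baseSet := by
    rwa [TangentBundle.trivializationAt_baseSet]
  rw [Trivialization.localFrame_apply_of_mem_baseSet _ _ hx', Trivialization.basisAt,
    Basis.map_apply, Trivialization.linearEquivAt_symm_apply,
    ← Trivialization.symmL_apply (R := ℝ) _ hx', TangentBundle.symmL_trivializationAt_eq_core hx]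
  rfl

/-- The coordinate frame of the chart at `x₀` is linearly independent at every point of the chart
source (Mathlib's `Trivialization.isLocalFrameOn_localFrame_baseSet`). [folklore] -/
theorem linearIndependent_localFrame_trivializationAt {x₀ x : M}
    (hx : x ∈ (chartAt H x₀).source) :
    LinearIndependent ℝ fun i ↦ (trivializationAt E (TangentSpace I) x₀).localFrame b i x := by
  have hx' : x ∈ (trivializationAt E (TangentSpace I) x₀).baseSet := by
    rwa [TangentBundle.trivializationAt_baseSet]
  exact ((trivializationAt E (TangentSpace I) x₀).isLocalFrameOn_localFrame_baseSet I ∞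
    b).linearIndependent hx'

/-- The coordinate frame of the chart at `x₀` consists of `C^∞` vector fields on the chart source
(Mathlib's `contMDiffAt_localFrame_of_mem`). Lee (2013), Prop. 8.11 / Ex. 10.11 (coordinate
frames are smooth local frames). [folklore] -/
theorem contMDiffAt_localFrame_trivializationAt {x₀ x : M}
    (hx : x ∈ (chartAt H x₀).source) (i : ι) :
    CMDiffAt ∞ (T% ((trivializationAt E (TangentSpace I) x₀).localFrame b i)) x := by
  have hx' : x ∈ (trivializationAt E (TangentSpace I) x₀).baseSet := by
    rwa [TangentBundle.trivializationAt_baseSet]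
  exact contMDiffAt_localFrame_of_mem _ _ _ i hx'

omit [IsManifold I ∞ M] in
/-- Transport of smoothness of a real-valued function from `M` to the chart: if `f` is `C^∞` at
`x₀` then `f ∘ φ₀⁻¹` is `C^∞` within `range I` at `φ₀ x₀` (the `ContDiffWithinAt` half of
`contMDiffAt_iff`, the chart of `ℝ` being the identity). [folklore] -/
theorem contDiffWithinAt_comp_extChartAt_symm_of_contMDiffAt {f : M → ℝ} {x₀ : M}
    (hf : CMDiffAt ∞ f x₀) :
    ContDiffWithinAt ℝ ∞ (f ∘ (extChartAt I x₀).symm) (range I) (extChartAt I x₀ x₀) := by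
  have := (contMDiffAt_iff.1 hf).2
  simpa only [extChartAt_model_space_eq_id, PartialEquiv.refl_coe, Function.id_comp] using this

end Frame

/-! ### Smoothness of the Gram determinant of the coordinate frame -/

section Riemannian

variable {E : Type*} [NormedAddCommGroup E] [NormedSpace ℝ E]
  {H : Type*} [TopologicalSpace H] {I : ModelWithCorners ℝ E H}
  {M : Type*} [TopologicalSpace M] [ChartedSpace H M] [IsManifold I ∞ M]
  [RiemannianBundle (fun x : M ↦ TangentSpace I x)]
  [IsContMDiffRiemannianBundle I ∞ E (fun x : M ↦ TangentSpace I x)]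

variable {ι : Type*} [Fintype ι] [DecidableEq ι] (b : Basis ι ℝ E)

/-- **The Gram determinant `det (g_{ij})`, `g_{ij} = ⟪sᵢ, sⱼ⟫`, of the coordinate frame of the
chart at `x₀` is a `C^∞` function on the chart source** (smooth metric, smooth frame; Leibniz
expansion of the determinant; the entries `x ↦ ⟪sᵢ x, sⱼ x⟫` are `C^∞` by Mathlib's
`ContMDiffAt.inner_bundle`, i.e. `g(X, Y)` is smooth for smooth `X, Y`, Lee (2013), Ch. 13,
p. 328). Lee (2013), Prop. 15.31 (the coefficient `√(det (g_{ij}))` is smooth).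
[cite: LeeSmoothManifolds2013, Prop. 15.31] -/
theorem contMDiffAt_det_gram_localFrame {x₀ x : M} (hx : x ∈ (chartAt H x₀).source) :
    CMDiffAt ∞ (fun x ↦ (Matrix.gram ℝ fun i ↦
      (trivializationAt E (TangentSpace I) x₀).localFrame b i x).det) x := by
  simp only [Matrix.det_apply', Matrix.gram_apply]
  refine contMDiffAt_finsetSum fun σ _ ↦ ?_
  refine contMDiffAt_const.mul (contMDiffAt_finsetProd fun i _ ↦ ?_)
  exact ContMDiffAt.inner_bundle (contMDiffAt_localFrame_trivializationAt b hx _)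
    (contMDiffAt_localFrame_trivializationAt b hx _)

end Riemannian

/-! ### The volume form in a chart and the discharge -/

section VolumeForm

variable {E : Type*} [NormedAddCommGroup E] [NormedSpace ℝ E] [FiniteDimensional ℝ E]
  {n : ℕ} [Fact (finrank ℝ E = n)]
  {H : Type*} [TopologicalSpace H] {I : ModelWithCorners ℝ E H}
  {M : Type*} [TopologicalSpace M] [ChartedSpace H M] [IsManifold I ∞ M]
  (o : (x : M) → Orientation ℝ (TangentSpace I x) (Fin n))
  [RiemannianBundle (fun x : M ↦ TangentSpace I x)]

/-- **The coefficient of the chart representative of the Riemannian volume form.** At the chart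
point of `x ∈ (extChartAt I x₀).source`, the representative of `vol_o` in the chart at `x₀`
evaluates on the reference frame `modelBasis E n` to `vol_{o x} (s₁ x, …, sₙ x)`, the volume
form on the coordinate frame (`MForm.inChart_apply_extChartAt` and
`localFrame_trivializationAt_eq_tangentCoordChange`). This is the coefficient `f` of
`ω_g = f dx¹ ∧ ⋯ ∧ dxⁿ` in Lee (2013), proof of Prop. 15.31. [cite: LeeSmoothManifolds2013, Prop. 15.31] -/
theorem inChart_riemannianVolumeForm_extChartAt_apply {x₀ x : M}
    (hx : x ∈ (extChartAt I x₀).source) :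
    (Literature.Geometry.Kaehler.riemannianVolumeForm o).inChart x₀ (extChartAt I x₀ x)
        (modelBasis E n) =
      (o x).volumeForm fun i ↦
        (trivializationAt E (TangentSpace I) x₀).localFrame (modelBasis E n) i x := by
  have hx' : x ∈ (chartAt H x₀).source := by rwa [← extChartAt_source I]
  rw [Literature.Geometry.Kaehler.MForm.inChart_apply_extChartAt _ hx,
    Literature.Geometry.Kaehler.riemannianVolumeForm_apply, Orientation.volumeFormL_apply]
  simp only [← localFrame_trivializationAt_eq_tangentCoordChange (modelBasis E n) hx']

/-- **Discharge of `isSmoothForm_riemannianVolumeForm_of_isContinuousOrientation`**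
(Lee (2013), Prop. 15.29: the Riemannian volume form of an oriented Riemannian manifold is a
smooth `n`-form; proved through the coordinate formula of Prop. 15.31,
`ω_g = ±√(det (g_{ij})) dx¹ ∧ ⋯ ∧ dxⁿ`). Near the centre of the chart at `x₀`, within
`range I`, the representative of `vol_o` is `(ε · √(det ⟪sᵢ, sⱼ⟫ ∘ φ₀⁻¹)) • dx¹ ∧ ⋯ ∧ dxⁿ`
with `ε = chartSign o x₀ (φ₀ x₀)` constant by `IsContinuousOrientation o`
(`inChart_riemannianVolumeForm_extChartAt_apply`, `volumeForm_apply_eq_sign_mul_sqrt`,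
`chartSign_eq_sign_inChart_riemannianVolumeForm`), and the Gram determinant of the
coordinate frame is smooth and nonvanishing (`contMDiffAt_det_gram_localFrame`,
`Matrix.det_gram_ne_zero_iff_linearIndependent`), so its square root is smooth
(`Real.contDiffAt_sqrt`). Boundary and corners are allowed; only the smoothness of the metric
(`IsContMDiffRiemannianBundle I ∞`) is used, not its continuity instance.
[cite: LeeSmoothManifolds2013, Prop. 15.29] -/
theorem isSmoothForm_riemannianVolumeForm_of_isContinuousOrientation_holds :
    isSmoothForm_riemannianVolumeForm_of_isContinuousOrientation o := by
  intro _ _ ho x₀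
  have hx₀ : x₀ ∈ (chartAt H x₀).source := mem_chart_source H x₀
  have hD := basisDetL_self (modelBasis E n)
  -- the Gram determinant of the coordinate frame is smooth and nonvanishing at `x₀`, so its
  -- square root, read in the chart, is `C^∞` within `range I` at the centre
  have hG := contMDiffAt_det_gram_localFrame (I := I) (modelBasis E n) hx₀
  have hG0 : (Matrix.gram ℝ fun i ↦
      (trivializationAt E (TangentSpace I) x₀).localFrame (modelBasis E n) i x₀).det ≠ 0 :=
    Matrix.det_gram_ne_zero_iff_linearIndependent.2
      (linearIndependent_localFrame_trivializationAt (modelBasis E n) hx₀)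
  have hsq := contDiffWithinAt_comp_extChartAt_symm_of_contMDiffAt
    (ContDiffAt.comp_contMDiffAt (g := Real.sqrt)
      (f := fun x ↦ (Matrix.gram ℝ fun i ↦
        (trivializationAt E (TangentSpace I) x₀).localFrame (modelBasis E n) i x).det)
      (Real.contDiffAt_sqrt hG0) hG)
  -- the coordinate formula `vol_o = (ε · √(det g_{ij})) • dx¹ ∧ ⋯ ∧ dxⁿ` near the centre
  have hev : ∀ᶠ y in 𝓝[range I] (extChartAt I x₀ x₀),
      (Literature.Geometry.Kaehler.riemannianVolumeForm o).inChart x₀ y =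
        (chartSign o x₀ (extChartAt I x₀ x₀) *
          ((fun x ↦ Real.sqrt (Matrix.gram ℝ fun i ↦
            (trivializationAt E (TangentSpace I) x₀).localFrame (modelBasis E n) i x).det) ∘
              (extChartAt I x₀).symm) y) • basisDetL (modelBasis E n) := by
    filter_upwards [extChartAt_target_mem_nhdsWithin x₀, ho x₀] with y hy hsign
    have hx : (extChartAt I x₀).symm y ∈ (extChartAt I x₀).source :=
      (extChartAt I x₀).map_target hy
    have hyx : y = extChartAt I x₀ ((extChartAt I x₀).symm y) :=
      ((extChartAt I x₀).right_inv hy).symm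
    rw [ContinuousAlternatingMap.eq_apply_basis_smul (modelBasis E n)
      ((Literature.Geometry.Kaehler.riemannianVolumeForm o).inChart x₀ y) _ hD]
    congr 1
    rw [← hsign.1, chartSign_eq_sign_inChart_riemannianVolumeForm, Function.comp_apply, hyx,
      inChart_riemannianVolumeForm_extChartAt_apply o hx, (extChartAt I x₀).left_inv hx]
    exact volumeForm_apply_eq_sign_mul_sqrt _ _
  have hpt : extChartAt I x₀ x₀ ∈ range I :=
    extChartAt_target_subset_range x₀ (mem_extChartAt_target x₀)
  refine ContDiffWithinAt.congr_of_eventuallyEq ?_ hev (hev.self_of_nhdsWithin hpt)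
  exact (contDiffWithinAt_const.mul hsq).smul contDiffWithinAt_const

end VolumeForm

end Literature.NumberTheory.Transcendental
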